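import Summits.Ventures.QEC.CircuitDistance.PortZSector
import Summits.Ventures.QEC.CircuitDistance.PortFibreCover
import HarnessLib

/-!
# P3-PORT (E5): the SECTOR THEOREMS in dischargeable form (cell `qec`, experiment CDX, seat qec-cdx-type-1; fix-forward of
# `PortXSector` / `PortZSector` after qec-cdx-idea-1's binder-domain note and the `b = 0` coverage case)

* `IsXClass T g` / `IsZClass T g`: `g` is a CLASS of the table (a generator support of the extended code, up to translation);
  the completeness binder now ranges over CLASS-WORDS only (for a non-class `g ∈ proj F` no realisation exists);
* budget-aware coverage checkers `XTable.covers₀` / `ZTable.covers₀` (the null clause is checked only for positive budget, so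
  `b = 0` leaves with `nulls = []` pass) with `xcovers₀_sound` / `zcovers₀_sound` (⇒ `Fibre.Covers₀`);
* per-leaf refutation taken as `¬ e.leaf.Realised` (from `.Unsat`, from a group-cube cover, or from the null split —
  `PortFibreCover`);
* **`no_xLogical_of_leaves₀`** / **`no_zLogical_of_leaves₀`**.
Nothing here asserts a value of `d_circ`.
-/

namespace Summit.Ventures.QEC.CircuitDistance

open Literature.InformationTheory.QuantumCodes

variable {ℓ m : ℕ} [NeZero ℓ] [NeZero m]

/-- `g` is an `X`-CLASS of the table: the (translated) class of some kind with a non-zero column. -/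
def IsXClass (T : XTable ℓ m) (g : Finset (BB.Mono ℓ m ⊕ BB.Mono ℓ m)) : Prop :=
  ∃ k ∈ XKind.all, ∃ i : BB.Mono ℓ m, (T.cls k).map (trQ i) = some g

/-- `g` is a `Z`-CLASS of the table. -/
def IsZClass (T : ZTable ℓ m) (g : Finset (BB.Mono ℓ m ⊕ BB.Mono ℓ m)) : Prop :=
  ∃ k ∈ ZKind.all, ∃ i : BB.Mono ℓ m, (T.cls k).map (trQ i) = some g

/-- Every class of a column of the `X`-sector DEM is an `X`-class. -/
theorem isXClass_of_cls (S : SMCode ℓ m) (T : XTable ℓ m) (Nc : ℕ) (f : Fault ℓ m) (g : Finset (BB.Mono ℓ m ⊕ BB.Mono ℓ m))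
    (h : (xDEM S T Nc).cls f = some g) : IsXClass T g := by
  change (f.xKind.bind fun ki => (T.cls ki.1).map (trQ ki.2)) = some g at h
  rcases hk : f.xKind with _ | ⟨k, i⟩
  · rw [hk] at h; simp at h
  · rw [hk, Option.bind_some] at h
    exact ⟨k, XKind.mem_all k (fun lay => Fault.xKind_ne_zero hk lay), i, h⟩

/-- Every class of a column of the `Z`-sector DEM is a `Z`-class. -/
theorem isZClass_of_cls (S : SMCode ℓ m) (T : ZTable ℓ m) (Nc : ℕ) (f : Fault ℓ m) (g : Finset (BB.Mono ℓ m ⊕ BB.Mono ℓ m))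
    (h : (zDEM S T Nc).cls f = some g) : IsZClass T g := by
  change (f.zKind.bind fun ki => (T.cls ki.1).map (trQ ki.2)) = some g at h
  rcases hk : f.zKind with _ | ⟨k, i⟩
  · rw [hk] at h; simp at h
  · rw [hk, Option.bind_some] at h
    exact ⟨k, ZKind.mem_all k (fun lay => Fault.zKind_ne_zero hk lay), i, h⟩

/-- Projections of column sets are class-words (abstract). -/
theorem isClass_of_mem_proj {ι δ γ V : Type*} [DecidableEq ι] [DecidableEq δ] [DecidableEq γ] [AddCommGroup V]
    [Module (ZMod 2) V] (D : Fibre.DEM ι δ γ V) (F : Finset ι) (g : γ) (hg : g ∈ Fibre.proj D F) :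
    ∃ i ∈ F, D.cls i = some g := by
  rw [Fibre.mem_proj] at hg
  have hpos := hg.pos
  unfold Fibre.mult at hpos
  obtain ⟨i, hi⟩ := Finset.card_pos.1 hpos
  exact ⟨i, (Finset.mem_filter.1 hi).1, (Finset.mem_filter.1 hi).2⟩

/-! ## Budget-aware coverage checkers -/

/-- DECIDABLE COVERAGE CHECK (budget-aware) of a leaf entry against the `X`-table. -/
def XTable.covers₀ (S : SMCode ℓ m) (T : XTable ℓ m) (Nc : ℕ) (e : LeafEntry ℓ m) : Bool :=
  decide (e.word.length = e.leaf.k) &&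
  (XKind.all.product (monoList ℓ m)).all fun ki =>
    match (T.cls ki.1).map (trQ ki.2) with
    | none => decide (e.leaf.budget = 0) || (List.range Nc).all fun c0 =>
        decide ((T.detFast S Nc ki.1 ki.2 (c0 + 1)).image encDet = ∅) ||
          e.leaf.nulls.any fun c => decide ((e.leaf.coordsOf c).toFinset = (T.detFast S Nc ki.1 ki.2 (c0 + 1)).image encDet)
    | some g => (List.range e.word.length).all fun j =>
        !decide (e.word[j]? = some g) ||
          (List.range Nc).all fun c0 =>
            (e.leaf.group j).any fun c => decide ((e.leaf.coordsOf c).toFinset = (T.detFast S Nc ki.1 ki.2 (c0 + 1)).image encDet)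

/-- DECIDABLE COVERAGE CHECK (budget-aware) of a leaf entry against the `Z`-table. -/
def ZTable.covers₀ (S : SMCode ℓ m) (T : ZTable ℓ m) (Nc : ℕ) (e : LeafEntry ℓ m) : Bool :=
  decide (e.word.length = e.leaf.k) &&
  (ZKind.all.product (monoList ℓ m)).all fun ki =>
    match (T.cls ki.1).map (trQ ki.2) with
    | none => decide (e.leaf.budget = 0) || (List.range Nc).all fun c0 =>
        decide ((T.detFast S ki.1 ki.2 (c0 + 1)).image encDet = ∅) ||
          e.leaf.nulls.any fun c => decide ((e.leaf.coordsOf c).toFinset = (T.detFast S ki.1 ki.2 (c0 + 1)).image encDet)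
    | some g => (List.range e.word.length).all fun j =>
        !decide (e.word[j]? = some g) ||
          (List.range Nc).all fun c0 =>
            (e.leaf.group j).any fun c => decide ((e.leaf.coordsOf c).toFinset = (T.detFast S ki.1 ki.2 (c0 + 1)).image encDet)

/-- **Coverage soundness** (`X`, budget-aware). -/
theorem xcovers₀_sound (S : SMCode ℓ m) (T : XTable ℓ m) (hS : T.ShapeCorrect S) (Nc : ℕ) (e : LeafEntry ℓ m)
    (h : T.covers₀ S Nc e = true) : Fibre.Covers₀ (xDEM S T Nc) (scope Nc) encDet e.word e.leaf := by
  unfold XTable.covers₀ at h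
  simp only [Bool.and_eq_true, decide_eq_true_eq, List.all_eq_true] at h
  obtain ⟨hlen, hall⟩ := h
  refine ⟨encDet_injective, hlen, fun f hf j hcls => ?_, ?_⟩
  · obtain ⟨h₁, h₂⟩ := hf
    change (f.xKind.bind fun ki => (T.cls ki.1).map (trQ ki.2)) = some e.word[j] at hcls
    rcases hk : f.xKind with _ | ⟨k, i⟩
    · rw [hk] at hcls; simp at hcls
    · rw [hk, Option.bind_some] at hcls
      have hkall : k ∈ XKind.all := XKind.mem_all k (fun lay => Fault.xKind_ne_zero hk lay)
      have hki := hall (k, i) (List.pair_mem_product.2 ⟨hkall, mem_monoList i⟩)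
      simp only [hcls] at hki
      rw [List.all_eq_true] at hki
      have hj := hki j (List.mem_range.2 j.2)
      simp only [Bool.or_eq_true, Bool.not_eq_true', decide_eq_false_iff_not, List.all_eq_true, List.any_eq_true,
        decide_eq_true_eq] at hj
      rcases hj with hj | hj
      · exact absurd (List.getElem?_eq_getElem j.2) hj
      · obtain ⟨c, hc, hcc⟩ := hj (f.cyc - 1) (List.mem_range.2 (by omega))
        refine ⟨c, hc, ?_⟩
        rw [hcc, Nat.sub_add_cancel h₁, XTable.detFast_eq_xDet (hS k hkall) Nc i f.cyc h₁ h₂, ← xDet_eq_of_xKind S Nc f hk]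
        rfl
  · by_cases hb : e.leaf.budget = 0
    · exact Or.inl hb
    · refine Or.inr fun f hf hcls => ?_
      obtain ⟨h₁, h₂⟩ := hf
      change (f.xKind.bind fun ki => (T.cls ki.1).map (trQ ki.2)) = none at hcls
      rcases hk : f.xKind with _ | ⟨k, i⟩
      · exact Or.inl (xDet_eq_empty_of_xKind S Nc f hk)
      · rw [hk, Option.bind_some] at hcls
        have hkall : k ∈ XKind.all := XKind.mem_all k (fun lay => Fault.xKind_ne_zero hk lay)
        have hki := hall (k, i) (List.pair_mem_product.2 ⟨hkall, mem_monoList i⟩)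
        simp only [hcls, hb, decide_false, Bool.false_or] at hki
        rw [List.all_eq_true] at hki
        have hc := hki (f.cyc - 1) (List.mem_range.2 (by omega))
        simp only [Bool.or_eq_true, decide_eq_true_eq, List.any_eq_true] at hc
        have hcol : (T.detFast S Nc k i (f.cyc - 1 + 1)).image encDet = (xDet S Nc f).image encDet := by
          rw [Nat.sub_add_cancel h₁, XTable.detFast_eq_xDet (hS k hkall) Nc i f.cyc h₁ h₂, ← xDet_eq_of_xKind S Nc f hk]
        rcases hc with hc | ⟨c, hcn, hcc⟩
        · left; rw [hcol, Finset.image_eq_empty] at hc; exact hc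
        · right; exact ⟨c, hcn, by rw [hcc, hcol]; rfl⟩

/-- **Coverage soundness** (`Z`, budget-aware). -/
theorem zcovers₀_sound (S : SMCode ℓ m) (T : ZTable ℓ m) (hS : T.ShapeCorrect S) (Nc : ℕ) (e : LeafEntry ℓ m)
    (h : T.covers₀ S Nc e = true) : Fibre.Covers₀ (zDEM S T Nc) (scope Nc) encDet e.word e.leaf := by
  unfold ZTable.covers₀ at h
  simp only [Bool.and_eq_true, decide_eq_true_eq, List.all_eq_true] at h
  obtain ⟨hlen, hall⟩ := h
  refine ⟨encDet_injective, hlen, fun f hf j hcls => ?_, ?_⟩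
  · obtain ⟨h₁, h₂⟩ := hf
    change (f.zKind.bind fun ki => (T.cls ki.1).map (trQ ki.2)) = some e.word[j] at hcls
    rcases hk : f.zKind with _ | ⟨k, i⟩
    · rw [hk] at hcls; simp at hcls
    · rw [hk, Option.bind_some] at hcls
      have hkall : k ∈ ZKind.all := ZKind.mem_all k (fun lay => Fault.zKind_ne_zero hk lay)
      have hki := hall (k, i) (List.pair_mem_product.2 ⟨hkall, mem_monoList i⟩)
      simp only [hcls] at hki
      rw [List.all_eq_true] at hki
      have hj := hki j (List.mem_range.2 j.2)
      simp only [Bool.or_eq_true, Bool.not_eq_true', decide_eq_false_iff_not, List.all_eq_true, List.any_eq_true,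
        decide_eq_true_eq] at hj
      rcases hj with hj | hj
      · exact absurd (List.getElem?_eq_getElem j.2) hj
      · obtain ⟨c, hc, hcc⟩ := hj (f.cyc - 1) (List.mem_range.2 (by omega))
        refine ⟨c, hc, ?_⟩
        rw [hcc, Nat.sub_add_cancel h₁, ZTable.detFast_eq_zDet (hS k hkall) Nc i f.cyc h₁ h₂, ← zDet_eq_of_zKind S Nc f hk]
        rfl
  · by_cases hb : e.leaf.budget = 0
    · exact Or.inl hb
    · refine Or.inr fun f hf hcls => ?_
      obtain ⟨h₁, h₂⟩ := hf
      change (f.zKind.bind fun ki => (T.cls ki.1).map (trQ ki.2)) = none at hcls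
      rcases hk : f.zKind with _ | ⟨k, i⟩
      · exact Or.inl (zDet_eq_empty_of_zKind S Nc f hk)
      · rw [hk, Option.bind_some] at hcls
        have hkall : k ∈ ZKind.all := ZKind.mem_all k (fun lay => Fault.zKind_ne_zero hk lay)
        have hki := hall (k, i) (List.pair_mem_product.2 ⟨hkall, mem_monoList i⟩)
        simp only [hcls, hb, decide_false, Bool.false_or] at hki
        rw [List.all_eq_true] at hki
        have hc := hki (f.cyc - 1) (List.mem_range.2 (by omega))
        simp only [Bool.or_eq_true, decide_eq_true_eq, List.any_eq_true] at hc
        have hcol : (T.detFast S k i (f.cyc - 1 + 1)).image encDet = (zDet S Nc f).image encDet := by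
          rw [Nat.sub_add_cancel h₁, ZTable.detFast_eq_zDet (hS k hkall) Nc i f.cyc h₁ h₂, ← zDet_eq_of_zKind S Nc f hk]
        rcases hc with hc | ⟨c, hcn, hcc⟩
        · left; rw [hcol, Finset.image_eq_empty] at hc; exact hc
        · right; exact ⟨c, hcn, by rw [hcc, hcol]; rfl⟩

/-! ## The sector theorems, dischargeable form -/

/-- Translating a list of generators as a finset map. -/
theorem word_map_toFinset (t : BB.Mono ℓ m) (xs : List (Finset (BB.Mono ℓ m ⊕ BB.Mono ℓ m))) :
    (xs.map (trQ t)).toFinset = xs.toFinset.map (genTranslateEquiv t).toEmbedding := by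
  ext g
  simp only [List.mem_toFinset, List.mem_map, Finset.mem_map_equiv]
  constructor
  · rintro ⟨a, ha, rfl⟩
    have : (genTranslateEquiv t).symm (genTranslateEquiv t a) = a := Equiv.symm_apply_apply _ _
    rw [genTranslateEquiv_apply] at this; rw [this]; exact ha
  · intro hg
    refine ⟨(genTranslateEquiv t).symm g, hg, ?_⟩
    rw [← genTranslateEquiv_apply, Equiv.apply_symm_apply]

/-- **`X`-SECTOR THEOREM (dischargeable form).** Tables correct; every listed leaf well-formed, covered (budget-aware), of
weight `w`, budget `≤ 1` and UNREALISED; the list COMPLETE up to translation for `X`-nontrivial CLASS-words of weight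
`≤ w` ⇒ no undetectable fault set of `≤ w` operations of the `N₀`-cycle circuit has an `X`-nontrivial residual. -/
theorem no_xLogical_of_leaves₀ (S : SMCode ℓ m) (T : XTable ℓ m) (hS : T.ShapeCorrect S) (hC : T.ClassCorrect S)
    (N₀ w : ℕ) (leaves : List (LeafEntry ℓ m))
    (hwf : ∀ e ∈ leaves, e.leaf.wf = true ∧ T.covers₀ S N₀ e = true ∧ e.word.Nodup ∧ e.leaf.w = w ∧ e.leaf.budget ≤ 1 ∧
      ¬ e.leaf.Realised)
    (hcomplete : ∀ x : Finset (Finset (BB.Mono ℓ m ⊕ BB.Mono ℓ m)), (∀ g ∈ x, IsXClass T g) →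
      XNontrivial S (∑ g ∈ x, indic g) → x.card ≤ w → ∃ e ∈ leaves, ∃ t : BB.Mono ℓ m, x = (e.word.map (trQ t)).toFinset) :
    ¬ ∃ F : Finset (Fault ℓ m), Undetectable S N₀ F ∧ dataX S N₀ F ∉ rowSpace S.toCode.HX ∧ faultCount F ≤ w := by
  classical
  rintro ⟨F, hU, hL, hw⟩
  obtain ⟨F₁, hR, hcard, himg, hX, hZ, hdX, hdZ⟩ := exists_reduced S N₀ F
  have hU₁ : Undetectable S N₀ F₁ := by
    refine ⟨fun f' hf' => ?_, fun t i => ⟨?_, ?_⟩⟩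
    · have : f'.loc ∈ F.image Fault.loc := himg (Finset.mem_image_of_mem _ hf')
      obtain ⟨f, hf, hfl⟩ := Finset.mem_image.1 this
      rw [← Fault.ev_eq_of_loc_eq hfl]; exact hU.1 f hf
    · rw [hX]; exact (hU.2 t i).1
    · rw [hZ]; exact (hU.2 t i).2
  have hNT : XNontrivial S (dataX S N₀ F₁) := ⟨(residual_syndrome_zero S N₀ F₁ hU₁).1, by rw [hdX]; exact hL⟩
  have hscope : ∀ f ∈ F₁, f ∈ scope (ℓ := ℓ) (m := m) N₀ := by
    intro f hf
    have := hU₁.1 f hf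
    rw [mem_allEvents_iff, Fault.ev_cyc] at this
    exact this
  have key := Fibre.no_silent_nontrivial (xDEM S T N₀) (scope N₀) (classHyp_xDEM S T hS hC N₀) (XNontrivial S)
    (fun v s hs => xNontrivial_add_stab S v s hs) w ?_ F₁ hscope (hcard.trans hw) (silent_xDEM S T N₀ F₁ hU₁)
  · apply key
    show XNontrivial S (∑ f ∈ F₁, dataX S N₀ {f})
    rw [← dataX_eq_sum]; exact hNT
  intro x hx hxw
  by_cases hcl : ∀ g ∈ x, IsXClass T g
  · obtain ⟨e, he, t, rfl⟩ := hcomplete x hcl hx hxw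
    obtain ⟨hwfe, hcov, hnd, hwe, hb, hnr⟩ := hwf e he
    have hcovers := xcovers₀_sound S T hS N₀ e hcov
    have hlen : e.word.length = e.leaf.k := hcovers.2.1
    rw [word_map_toFinset, Finset.card_map, List.toFinset_card_of_nodup hnd, hlen]
    show ¬ Fibre.TightRealisable (xDEM S T N₀) (scope N₀) (e.word.toFinset.map (xSymm S T N₀ t).onGen.toEmbedding) _
    rw [Fibre.tightRealisable_map_iff (xDEM S T N₀) (scope N₀) (xSymm S T N₀ t)]
    have hbud : w - e.leaf.k = e.leaf.budget := by unfold Fibre.Leaf.budget; rw [hwe]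
    rw [hbud]
    exact Fibre.not_tightRealisable_of_notRealised₀ (xDEM S T N₀) (scope N₀) encDet e.word hnd e.leaf hcovers hnr hb
  · -- a non-class word is never realised
    push Not at hcl
    obtain ⟨g, hgx, hg⟩ := hcl
    rintro ⟨G, -, -, hproj, -⟩
    have hgp : g ∈ Fibre.proj (xDEM S T N₀) G := by rw [hproj]; exact hgx
    obtain ⟨f, -, hf⟩ := isClass_of_mem_proj (xDEM S T N₀) G g hgp
    exact hg (isXClass_of_cls S T N₀ f g hf)

/-- **`Z`-SECTOR THEOREM (dischargeable form).** -/
theorem no_zLogical_of_leaves₀ (S : SMCode ℓ m) (T : ZTable ℓ m) (hS : T.ShapeCorrect S) (hC : T.ClassCorrect S)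
    (N₀ w : ℕ) (leaves : List (LeafEntry ℓ m))
    (hwf : ∀ e ∈ leaves, e.leaf.wf = true ∧ T.covers₀ S N₀ e = true ∧ e.word.Nodup ∧ e.leaf.w = w ∧ e.leaf.budget ≤ 1 ∧
      ¬ e.leaf.Realised)
    (hcomplete : ∀ x : Finset (Finset (BB.Mono ℓ m ⊕ BB.Mono ℓ m)), (∀ g ∈ x, IsZClass T g) →
      ZNontrivial S (∑ g ∈ x, indic g) → x.card ≤ w → ∃ e ∈ leaves, ∃ t : BB.Mono ℓ m, x = (e.word.map (trQ t)).toFinset) :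
    ¬ ∃ F : Finset (Fault ℓ m), Undetectable S N₀ F ∧ dataZ S N₀ F ∉ rowSpace S.toCode.HZ ∧ faultCount F ≤ w := by
  classical
  rintro ⟨F, hU, hL, hw⟩
  obtain ⟨F₁, hR, hcard, himg, hX, hZ, hdX, hdZ⟩ := exists_reduced S N₀ F
  have hU₁ : Undetectable S N₀ F₁ := by
    refine ⟨fun f' hf' => ?_, fun t i => ⟨?_, ?_⟩⟩
    · have : f'.loc ∈ F.image Fault.loc := himg (Finset.mem_image_of_mem _ hf')
      obtain ⟨f, hf, hfl⟩ := Finset.mem_image.1 this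
      rw [← Fault.ev_eq_of_loc_eq hfl]; exact hU.1 f hf
    · rw [hX]; exact (hU.2 t i).1
    · rw [hZ]; exact (hU.2 t i).2
  have hNT : ZNontrivial S (dataZ S N₀ F₁) := ⟨(residual_syndrome_zero S N₀ F₁ hU₁).2, by rw [hdZ]; exact hL⟩
  have hscope : ∀ f ∈ F₁, f ∈ scope (ℓ := ℓ) (m := m) N₀ := by
    intro f hf
    have := hU₁.1 f hf
    rw [mem_allEvents_iff, Fault.ev_cyc] at this
    exact this
  have key := Fibre.no_silent_nontrivial (zDEM S T N₀) (scope N₀) (classHyp_zDEM S T hS hC N₀) (ZNontrivial S)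
    (fun v s hs => zNontrivial_add_stab S v s hs) w ?_ F₁ hscope (hcard.trans hw) (silent_zDEM S T N₀ F₁ hU₁)
  · apply key
    show ZNontrivial S (∑ f ∈ F₁, dataZ S N₀ {f})
    rw [← dataZ_eq_sum]; exact hNT
  intro x hx hxw
  by_cases hcl : ∀ g ∈ x, IsZClass T g
  · obtain ⟨e, he, t, rfl⟩ := hcomplete x hcl hx hxw
    obtain ⟨hwfe, hcov, hnd, hwe, hb, hnr⟩ := hwf e he
    have hcovers := zcovers₀_sound S T hS N₀ e hcov
    have hlen : e.word.length = e.leaf.k := hcovers.2.1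
    rw [word_map_toFinset, Finset.card_map, List.toFinset_card_of_nodup hnd, hlen]
    show ¬ Fibre.TightRealisable (zDEM S T N₀) (scope N₀) (e.word.toFinset.map (zSymm S T N₀ t).onGen.toEmbedding) _
    rw [Fibre.tightRealisable_map_iff (zDEM S T N₀) (scope N₀) (zSymm S T N₀ t)]
    have hbud : w - e.leaf.k = e.leaf.budget := by unfold Fibre.Leaf.budget; rw [hwe]
    rw [hbud]
    exact Fibre.not_tightRealisable_of_notRealised₀ (zDEM S T N₀) (scope N₀) encDet e.word hnd e.leaf hcovers hnr hb
  · push Not at hcl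
    obtain ⟨g, hgx, hg⟩ := hcl
    rintro ⟨G, -, -, hproj, -⟩
    have hgp : g ∈ Fibre.proj (zDEM S T N₀) G := by rw [hproj]; exact hgx
    obtain ⟨f, -, hf⟩ := isClass_of_mem_proj (zDEM S T N₀) G g hgp
    exact hg (isZClass_of_cls S T N₀ f g hf)

end Summit.Ventures.QEC.CircuitDistance
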